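import Mathlib
import Literature.Analysis.PDE.SingleEntropy.Subsolution
import HarnessLib

/-!
# Tools for the supersolution property: Lipschitz gluing and a smooth cutoff profile

Topic `Literature/Analysis/PDE/SingleEntropy` — part of the formalization of
De Lellis–Otto–Westdickenberg, *Minimal entropy conditions for Burgers equation*, Quart. Appl.
Math. 62 (2004) 687–700, Thm 2.3 / Cor 2.5 (the named fact
`Literature.Analysis.PDE.deLellisOttoWestdickenberg_singleEntropy`).

* `integral_lineDeriv_eq_zero`: `∫ ∂ᵥψ = 0` for compactly supported Lipschitz `ψ`;
* `lipschitzWith_of_ball`: Lipschitz on a ball and zero outside a smaller concentric ball ⇒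
  globally Lipschitz;
* `exists_cutoff`: the smooth nonincreasing profile `χ(s) = (δ - s)(1 - S(4s/δ - 2))`
  (`S` = `Real.smoothTransition`) with `χ = δ - s` on `s ≤ δ/2`, `χ = 0` on `s ≥ 3δ/4`.
[folklore]
-/

noncomputable section

open MeasureTheory Set Filter Metric ContinuousLinearMap
open scoped Topology Convolution NNReal

namespace Literature.Analysis.PDE.SingleEntropy

/-! ## Tools for the supersolution property (DLOW §4.2, weighted variant) -/

section SupersolutionTools

open scoped NNReal

/-- The integral of a line derivative of a compactly supported Lipschitz function vanishes.
[folklore] -/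
theorem integral_lineDeriv_eq_zero {ψ : ℝ × ℝ → ℝ} {L : ℝ≥0} (hψ : LipschitzWith L ψ)
    (hψc : HasCompactSupport ψ) (v : ℝ × ℝ) : ∫ z, lineDeriv ℝ ψ z v = 0 := by
  obtain ⟨R₀, hR₀⟩ : ∃ R₀, tsupport ψ ⊆ closedBall (0 : ℝ × ℝ) R₀ :=
    hψc.isCompact.isBounded.subset_closedBall 0
  let b : ContDiffBump (0 : ℝ × ℝ) := ⟨|R₀| + 1, |R₀| + 2, by positivity, by linarith⟩
  have hbin : ∀ z ∈ tsupport ψ, z ∈ ball (0 : ℝ × ℝ) (|R₀| + 1) := fun z hz => by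
    have := hR₀ hz
    rw [mem_closedBall] at this
    rw [mem_ball]
    linarith [le_abs_self R₀]
  have hb1 : ∀ z ∈ ball (0 : ℝ × ℝ) (|R₀| + 1), b z = 1 := fun z hz =>
    b.one_of_mem_closedBall (ball_subset_closedBall hz)
  obtain ⟨D, hD⟩ := ContDiff.lipschitzWith_of_hasCompactSupport b.hasCompactSupport
    (b.contDiff (n := 1)) one_ne_zero
  have key := hψ.integral_lineDeriv_mul_eq (μ := volume) hD b.hasCompactSupport v
  have l1 : ∫ z, lineDeriv ℝ ψ z v * b z = ∫ z, lineDeriv ℝ ψ z v := by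
    congr 1; funext z
    by_cases hz : z ∈ tsupport ψ
    · rw [hb1 z (hbin z hz), mul_one]
    · rw [lineDeriv_eq_zero_of_notMem_tsupport hz, zero_mul]
  have l2 : ∫ z, lineDeriv ℝ (b : ℝ × ℝ → ℝ) z (-v) * ψ z = 0 := by
    have : ∀ z, lineDeriv ℝ (b : ℝ × ℝ → ℝ) z (-v) * ψ z = 0 := by
      intro z
      by_cases hz : z ∈ tsupport ψ
      · have hnear : (b : ℝ × ℝ → ℝ) =ᶠ[𝓝 z] fun _ => (1 : ℝ) :=
          Filter.eventually_of_mem (isOpen_ball.mem_nhds (hbin z hz)) (fun y hy => hb1 y hy)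
        have hd : HasFDerivAt (b : ℝ × ℝ → ℝ) (0 : ℝ × ℝ →L[ℝ] ℝ) z :=
          (hasFDerivAt_const (1 : ℝ) z).congr_of_eventuallyEq hnear
        rw [hd.differentiableAt.lineDeriv_eq_fderiv, hd.fderiv]
        simp
      · rw [image_eq_zero_of_notMem_tsupport hz, mul_zero]
    simp [this]
  rw [← l1, key, l2]

/-- **Gluing lemma for Lipschitz functions**: Lipschitz on a ball and zero outside a smaller
concentric ball implies globally Lipschitz (sup-norm balls; intermediate value theorem along
segments). [folklore] -/
theorem lipschitzWith_of_ball {ψ : ℝ × ℝ → ℝ} {z₀ : ℝ × ℝ} {ρ₁ ρ₂ : ℝ} {L : ℝ≥0} (h12 : ρ₁ < ρ₂)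
    (hL : LipschitzOnWith L ψ (ball z₀ ρ₂)) (h0 : ∀ z ∉ ball z₀ ρ₁, ψ z = 0) :
    LipschitzWith L ψ := by
  have main : ∀ a b, a ∈ ball z₀ ρ₁ → b ∉ ball z₀ ρ₂ → dist (ψ a) (ψ b) ≤ L * dist a b := by
    intro a b ha hb
    have hγc : Continuous fun t : ℝ => dist (a + t • (b - a)) z₀ := by fun_prop
    have h0' : dist (a + (0 : ℝ) • (b - a)) z₀ < ρ₁ := by simpa using mem_ball.mp ha
    have h1' : ρ₂ ≤ dist (a + (1 : ℝ) • (b - a)) z₀ := by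
      have : ¬dist b z₀ < ρ₂ := fun h => hb (mem_ball.mpr h)
      simpa using not_lt.mp this
    obtain ⟨t, ht, hteq⟩ := intermediate_value_Icc zero_le_one hγc.continuousOn
      (show (ρ₁ + ρ₂) / 2 ∈ Icc (dist (a + (0 : ℝ) • (b - a)) z₀) (dist (a + (1 : ℝ) • (b - a)) z₀)
        from ⟨by linarith, by linarith⟩)
    have hteq' : dist (a + t • (b - a)) z₀ = (ρ₁ + ρ₂) / 2 := hteq
    set c : ℝ × ℝ := a + t • (b - a) with hc
    have hc2 : c ∈ ball z₀ ρ₂ := mem_ball.mpr (by simp only [hc]; rw [hteq']; linarith)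
    have hc1 : c ∉ ball z₀ ρ₁ := fun h => by
      have := mem_ball.mp h; simp only [hc] at this; rw [hteq'] at this; linarith
    have hψc : ψ c = 0 := h0 _ hc1
    have hψb : ψ b = 0 := h0 _ (fun h => hb (ball_subset_ball h12.le h))
    have hdist : dist a c ≤ dist a b := by
      simp only [hc, dist_eq_norm]
      rw [show a - (a + t • (b - a)) = -(t • (b - a)) by abel, norm_neg, norm_smul,
        Real.norm_eq_abs, abs_of_nonneg ht.1, norm_sub_rev]
      exact mul_le_of_le_one_left (norm_nonneg _) ht.2
    calc dist (ψ a) (ψ b) = dist (ψ a) (ψ c) := by rw [hψb, hψc]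
      _ ≤ L * dist a c := hL.dist_le_mul a (ball_subset_ball h12.le ha) c hc2
      _ ≤ L * dist a b := mul_le_mul_of_nonneg_left hdist L.2
  apply LipschitzWith.of_dist_le_mul
  intro a b
  by_cases ha2 : a ∈ ball z₀ ρ₂ <;> by_cases hb2 : b ∈ ball z₀ ρ₂
  · exact hL.dist_le_mul a ha2 b hb2
  · by_cases ha1 : a ∈ ball z₀ ρ₁
    · exact main a b ha1 hb2
    · rw [h0 a ha1, h0 b (fun h => hb2 (ball_subset_ball h12.le h)), dist_self]
      positivity
  · by_cases hb1 : b ∈ ball z₀ ρ₁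
    · rw [dist_comm, dist_comm a]
      exact main b a hb1 ha2
    · rw [h0 b hb1, h0 a (fun h => ha2 (ball_subset_ball h12.le h)), dist_self]
      positivity
  · rw [h0 a (fun h => ha2 (ball_subset_ball h12.le h)),
      h0 b (fun h => hb2 (ball_subset_ball h12.le h)), dist_self]
    positivity

/-- The derivative of `Real.smoothTransition` is nonnegative, bounded, and vanishes off `[0,1]`. [folklore] -/
theorem smoothTransition_deriv_props :
    (∀ x, 0 ≤ deriv Real.smoothTransition x) ∧ (∀ x, x < 0 → deriv Real.smoothTransition x = 0) ∧
    (∀ x, 1 < x → deriv Real.smoothTransition x = 0) ∧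
    ∃ C, 0 ≤ C ∧ ∀ x, deriv Real.smoothTransition x ≤ C := by
  have hmono := Real.smoothTransition.monotone
  have h1 : ∀ x, 0 ≤ deriv Real.smoothTransition x := fun x => hmono.deriv_nonneg
  have h2 : ∀ x, x < 0 → deriv Real.smoothTransition x = 0 := by
    intro x hx
    have : Real.smoothTransition =ᶠ[𝓝 x] fun _ => (0 : ℝ) :=
      Filter.eventually_of_mem (Iio_mem_nhds hx) fun y hy =>
        Real.smoothTransition.zero_of_nonpos (le_of_lt hy)
    rw [this.deriv_eq, deriv_const]
  have h3 : ∀ x, 1 < x → deriv Real.smoothTransition x = 0 := by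
    intro x hx
    have : Real.smoothTransition =ᶠ[𝓝 x] fun _ => (1 : ℝ) :=
      Filter.eventually_of_mem (Ioi_mem_nhds hx) fun y hy =>
        Real.smoothTransition.one_of_one_le (le_of_lt hy)
    rw [this.deriv_eq, deriv_const]
  refine ⟨h1, h2, h3, ?_⟩
  have hcont : Continuous (deriv Real.smoothTransition) :=
    Real.smoothTransition.contDiff.continuous_deriv (n := 1) le_rfl
  obtain ⟨C, hC⟩ := (isCompact_Icc (a := (0 : ℝ)) (b := 1)).exists_bound_of_continuousOn
    hcont.continuousOn
  refine ⟨max C 0, le_max_right _ _, fun x => ?_⟩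
  by_cases hx0 : x < 0
  · rw [h2 x hx0]; exact le_max_right _ _
  by_cases hx1 : 1 < x
  · rw [h3 x hx1]; exact le_max_right _ _
  have hx : x ∈ Icc (0 : ℝ) 1 := ⟨not_lt.mp hx0, not_lt.mp hx1⟩
  have := hC x hx
  rw [Real.norm_eq_abs] at this
  exact (le_abs_self _).trans (this.trans (le_max_left _ _))

/-- **The cutoff profile.** For `δ > 0` there is a smooth nonincreasing `χ ≥ 0` with
`χ(s) = δ - s` for `s ≤ δ/2`, `χ(s) = 0` for `s ≥ 3δ/4`, `χ' = -1` on `s < δ/2` and `χ'` bounded.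
(Here `χ(s) = (δ - s)(1 - S(4s/δ - 2))` with Mathlib's `Real.smoothTransition` `S`.) [folklore] -/
theorem exists_cutoff {δ : ℝ} (hδ : 0 < δ) :
    ∃ χ : ℝ → ℝ, ContDiff ℝ (⊤ : ℕ∞) χ ∧ (∀ s, s ≤ δ / 2 → χ s = δ - s) ∧
      (∀ s, 3 * δ / 4 ≤ s → χ s = 0) ∧ (∀ s, 0 ≤ χ s) ∧ (∀ s, deriv χ s ≤ 0) ∧
      (∃ C, 0 ≤ C ∧ ∀ s, -C ≤ deriv χ s) ∧ (∀ s, s < δ / 2 → deriv χ s = -1) ∧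
      (∀ s, 3 * δ / 4 < s → deriv χ s = 0) := by
  obtain ⟨hS1, hS2, hS3, C, hC0, hSC⟩ := smoothTransition_deriv_props
  set S := Real.smoothTransition with hSdef
  have hSone : ∀ x, 1 ≤ x → S x = 1 := fun x hx => by
    rw [hSdef]; exact Real.smoothTransition.one_of_one_le hx
  have hSzero : ∀ x, x ≤ 0 → S x = 0 := fun x hx => by
    rw [hSdef]; exact Real.smoothTransition.zero_of_nonpos hx
  have hSle : ∀ x, S x ≤ 1 := fun x => by rw [hSdef]; exact Real.smoothTransition.le_one x
  have hSnn : ∀ x, 0 ≤ S x := fun x => by rw [hSdef]; exact Real.smoothTransition.nonneg x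
  -- derivative formula
  have hderiv : ∀ s, HasDerivAt (fun s => (δ - s) * (1 - S (4 * s / δ - 2)))
      ((-1) * (1 - S (4 * s / δ - 2))
        + (δ - s) * (-(deriv S (4 * s / δ - 2) * (4 / δ)))) s := by
    intro s
    have ha : HasDerivAt (fun s => 4 * s / δ - 2) (4 / δ) s := by
      have := ((hasDerivAt_id s).const_mul 4).div_const δ |>.sub_const 2
      simpa using this
    have hSd : HasDerivAt S (deriv S (4 * s / δ - 2)) (4 * s / δ - 2) :=
      ((Real.smoothTransition.contDiff (n := 1)).differentiable one_ne_zero _).hasDerivAt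
    have hcomp := hSd.comp s ha
    have h1 : HasDerivAt (fun s => δ - s) (-1) s := by
      simpa using (hasDerivAt_id s).const_sub δ
    have h2 : HasDerivAt (fun s => 1 - S (4 * s / δ - 2)) (-(deriv S (4 * s / δ - 2) * (4 / δ))) s := by
      have := hcomp.const_sub (1 : ℝ)
      simpa [Function.comp] using this
    exact h1.mul h2
  have hderiv' : ∀ s, deriv (fun s => (δ - s) * (1 - S (4 * s / δ - 2))) s
      = (-1) * (1 - S (4 * s / δ - 2)) + (δ - s) * (-(deriv S (4 * s / δ - 2) * (4 / δ))) :=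
    fun s => (hderiv s).deriv
  refine ⟨fun s => (δ - s) * (1 - S (4 * s / δ - 2)), ?_, ?_, ?_, ?_, ?_, ?_, ?_, ?_⟩
  · simp only [hSdef]
    exact (contDiff_const.sub contDiff_id).mul
      (contDiff_const.sub (Real.smoothTransition.contDiff.comp (by fun_prop)))
  · intro s hs
    have : 4 * s / δ - 2 ≤ 0 := by
      rw [sub_nonpos, div_le_iff₀ hδ]; linarith
    simp [hSzero _ this]
  · intro s hs
    have : 1 ≤ 4 * s / δ - 2 := by
      rw [le_sub_iff_add_le, le_div_iff₀ hδ]; linarith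
    simp [hSone _ this]
  · intro s
    by_cases hs : s ≤ δ
    · exact mul_nonneg (by linarith) (by linarith [hSle (4 * s / δ - 2)])
    · have : 1 ≤ 4 * s / δ - 2 := by
        rw [le_sub_iff_add_le, le_div_iff₀ hδ]; linarith
      simp [hSone _ this]
  · intro s
    rw [hderiv']
    by_cases hs : s ≤ δ
    · have t1 : 0 ≤ 1 - S (4 * s / δ - 2) := by linarith [hSle (4 * s / δ - 2)]
      have t2 : 0 ≤ (δ - s) * (deriv S (4 * s / δ - 2) * (4 / δ)) :=
        mul_nonneg (by linarith) (mul_nonneg (hS1 _) (by positivity))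
      nlinarith
    · have hgt : 1 < 4 * s / δ - 2 := by
        rw [lt_sub_iff_add_lt, lt_div_iff₀ hδ]; linarith
      rw [hS3 _ hgt, hSone _ hgt.le]
      simp
  · refine ⟨1 + δ * (C * (4 / δ)), by positivity, fun s => ?_⟩
    rw [hderiv']
    have t1 : (1 : ℝ) - S (4 * s / δ - 2) ≤ 1 := by linarith [hSnn (4 * s / δ - 2)]
    by_cases hs : s ≤ δ
    · by_cases hs' : δ / 2 ≤ s
      · have t2 : (δ - s) * (deriv S (4 * s / δ - 2) * (4 / δ)) ≤ δ * (C * (4 / δ)) :=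
          mul_le_mul (by linarith) (mul_le_mul_of_nonneg_right (hSC _) (by positivity))
            (mul_nonneg (hS1 _) (by positivity)) hδ.le
        nlinarith
      · have hlt : 4 * s / δ - 2 < 0 := by
          rw [sub_neg, div_lt_iff₀ hδ]; linarith
        rw [hS2 _ hlt, hSzero _ hlt.le]
        have : 0 ≤ δ * (C * (4 / δ)) := by positivity
        nlinarith
    · have hgt : 1 < 4 * s / δ - 2 := by
        rw [lt_sub_iff_add_lt, lt_div_iff₀ hδ]; linarith
      rw [hS3 _ hgt, hSone _ hgt.le]
      have : 0 ≤ δ * (C * (4 / δ)) := by positivity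
      simp; nlinarith
  · intro s hs
    have hlt : 4 * s / δ - 2 < 0 := by
      rw [sub_neg, div_lt_iff₀ hδ]; linarith
    rw [hderiv', hS2 _ hlt, hSzero _ hlt.le]
    ring
  · intro s hs
    have hgt : 1 < 4 * s / δ - 2 := by
      rw [lt_sub_iff_add_lt, lt_div_iff₀ hδ]; linarith
    rw [hderiv', hS3 _ hgt, hSone _ hgt.le]
    simp

end SupersolutionTools

end Literature.Analysis.PDE.SingleEntropy
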